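import Mathlib
import HarnessLib
import HarnessLib.Audit
import Summits.HodgeConjecture.Statement
import Literature.AlgebraicGeometry.HodgeTheory.AlgebraicityLocusStrata
import Literature.AlgebraicGeometry.HodgeTheory.ComplexConjugationHolds
import HarnessLib.Audit.Status.Attr

/-!
Route: MumfordCurveRigidFibreCount

# Route MumfordCurveRigidFibreCount — Infinitely many CM anchors on a compact Mumford curve saturate
the exceptional classes

It suffices to show INFINITE-ANCHOR SATURATION (X = `InfiniteAnchorSaturation`): on a smooth
projective family f : 𝒜 → V of relative dimension 8 over a smooth projective (compact) curve V/ℂ, a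
global degree-4 class δ whose fibre restrictions are all rational of Hodge type (2,2) and which is
ALGEBRAIC AT INFINITELY MANY FIBRES is algebraic at every fibre. The case of record — and the only
known non-trivial instance — is Mumford's fibre-square families 𝒜₂ → V_M over compact quaternionic
Shimura curves with δ ∈ {δ₁, δ₂} the two exceptional (2,2)-classes of BouchetEtAl2025 §5.1 (printed
open: "it is unknown whether the Hodge classes mentioned above are algebraic") and the anchors = the
CM points (algebraic there by the folder theorem G1 ⇐ Markman2025SecantWeil). X plus the proved
sector glue gives HC on every fibre of every Mumford-shaped datum; the declared RESIDUAL
`MumfordSectorComplement` (HC off that sector) finishes. Realises sketch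
mumford-curve-rigid-fibre-count (reader PASS, markdown wave 2026-08-17).
Lean: `∀ (V 𝒜 : Literature.AlgebraicGeometry.Motives.SchemeOver ℂ) (f : 𝒜 ⟶ V),
Literature.AlgebraicGeometry.Motives.IsSmoothProjective 1 V →
Literature.AlgebraicGeometry.Motives.IsSmoothProjectiveFamily f 8 →
Literature.AlgebraicGeometry.HodgeTheory.IsQuasiProjectiveOver 𝒜 → ∀ (δ :
Literature.AlgebraicGeometry.HodgeTheory.complexBetti 𝒜 (2 * 2)), (∀ t :
Literature.AlgebraicGeometry.Motives.ComplexPoints V,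
Literature.AlgebraicGeometry.HodgeTheory.IsRationalClass
(Literature.AlgebraicGeometry.HodgeTheory.complexBetti.map
(Literature.AlgebraicGeometry.Motives.fiberι f t) (2 * 2) δ) ∧
Literature.AlgebraicGeometry.HodgeTheory.IsOfHodgeType 8
(Literature.AlgebraicGeometry.Motives.fiberOver f t) (2 * 2) 2 2
(Literature.AlgebraicGeometry.HodgeTheory.complexBetti.map
(Literature.AlgebraicGeometry.Motives.fiberι f t) (2 * 2) δ)) → {s :
Literature.AlgebraicGeometry.Motives.ComplexPoints V |
Literature.AlgebraicGeometry.HodgeTheory.complexBetti.map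
(Literature.AlgebraicGeometry.Motives.fiberι f s) (2 * 2) δ ∈
Literature.AlgebraicGeometry.HodgeTheory.algebraicClasses
(Literature.AlgebraicGeometry.Motives.fiberOver f s) 2}.Infinite → ∀ t :
Literature.AlgebraicGeometry.Motives.ComplexPoints V,
Literature.AlgebraicGeometry.HodgeTheory.complexBetti.map
(Literature.AlgebraicGeometry.Motives.fiberι f t) (2 * 2) δ ∈
Literature.AlgebraicGeometry.HodgeTheory.algebraicClasses
(Literature.AlgebraicGeometry.Motives.fiberOver f t) 2`

## Assembly
Pure logic plus one proved Literature theorem. Given X, every Mumford-shaped datum satisfies HC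
fibrewise: the anti-vacuity conjunct of `HodgeConjectureFor 8 (fiberOver f t)` is
`nonempty_hodgeModel_holds` applied to the fibre (smooth projective by
`IsSmoothProjectiveFamily.isSmoothProjective`); the cycle conjunct is the datum's CM hypothesis when
t ∈ CM, and otherwise the datum's generation hypothesis fed with X (anchor set := CM, where δ_i|_s
is algebraic because it is a rational (2,2)-class at a CM fibre). This is the theorem
`mumfordSectorHodge_of` proved inside `closes`; the residual `MumfordSectorComplement` then yields
`_root_.HodgeConjecture`. Deciding theorem: `closes (hX : InfiniteAnchorSaturation) (hR :
MumfordSectorComplement) : HodgeConjecture` (glue.lean, certified). The `Assembly` item records the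
frame X → R → HC (it is the statement of `closes`, provable by the same term).

Rationale: WHY THIS LINE. Mechanism (BouchetEtAl2025 §5.1, Mumford1969NoteShimura, MoonenZarhin1999LowDim,
CharlesSchnell2014Notes Prop. 11.3.11): on a COMPACT one-dimensional base every Zariski-closed
stratum of the algebraicity locus of δ is FINITE OR EVERYTHING (`curveStrataDichotomy`, proved in
the skeleton), so "δ algebraic everywhere" is EQUIVALENT to "the algebraicity locus is uncountable"
(rung `uncountableAnchorSaturation_of` PROVED from the Charles–Schnell fact; open skeleton stub
`stub_uncountableLocus`; composition `InfiniteAnchorSaturation_of` kernel-checked): a 0–∞ law that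
turns the Hodge question on the Mumford sector into a COUNTING problem on the CM points — is the
minimal projective complexity κ(s) of a cycle representing δ|_s bounded along infinitely many CM
points (then everywhere), or properly divergent? The imported area is the arithmetic of special
points on Shimura curves (CM supply by discriminant, Hecke orbits; BaldiKlinglerUllmo2024 for the
counter-pressure) set against effective algebraicity at CM fibres (Markman2025SecantWeil + the
isolation lemma of the folder paper G1). What it does that prior routes do not:
route-HodgeConjecture-AnchorTransport transports algebraicity from ONE anchor over an arbitrary base
(Grothendieck's VHC, semiregularity); route-HodgeConjecture-HeckeOrbitCompactness asks a UNIFORM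
degree bound along one Hecke orbit in the Weil-type (unitary) sector; here the base is a compact
CURVE, the anchors are ALL CM points (free, infinite, arithmetically graded), the class is
Mumford-type exceptional (neither Weil-type nor divisor-generated, BouchetEtAl2025 §5.1 "neither
framework"), and the demand is a RATE (polynomial cost vs polynomial CM supply), strictly weaker
than a uniform bound. Negatives index (3 entries: MilnorK symbol lift, Fermat sextic multisets,
E-line Gram matrices) is untouched.

RANKED CRUXES. #2 InfiniteAnchorSaturation (crux) — X itself (sketch item X / BHPS §5.1 instance):
for every smooth projective family f : 𝒜 → V of relative dimension 8 over a smooth projective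
geometrically irreducible curve V/ℂ with 𝒜 quasi-projective, every global class δ ∈ H⁴(𝒜(ℂ);ℂ) whose
fibre restrictions are all rational of type (2,2), algebraic at infinitely many complex points of V,
is algebraic at every complex point. A consequence of HC (any failure is a non-algebraic rational
(2,2)-class on a smooth projective 8-fold); implied by Grothendieck's variational Hodge conjecture
on curve bases; the Mumford fibre squares with δ = δ_i and anchors = CM points are the instance of
record. [difficulty: open-problem] (why it might fail: Only with HC. Strategic failure = PROPER CM
COST: κ(s) finite at every CM point but unbounded (every stratum finite), the anchors dodging the
countably many finite strata one by one — nothing known excludes it (BKU2024: special points are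
sparse in every uniform sense).) [BouchetEtAl2025, CharlesSchnell2014Notes, Mumford1969NoteShimura,
MoonenZarhin1999LowDim, Markman2025SecantWeil, BaldiKlinglerUllmo2024]
#3 MumfordSectorComplement (crux) — RESIDUAL (declared `residual`; HC off the Mumford-shaped
fibre-square sector): if the Hodge conjecture holds for every fibre of every MUMFORD-SHAPED SECTOR
DATUM — a smooth projective family f : 𝒜 → V of relative dimension 8 over a smooth projective curve,
𝒜 quasi-projective, two global degree-4 classes δ₀, δ₁ with rational (2,2) fibre restrictions, an
infinite set CM ⊆ V(ℂ) at whose fibres every rational (p,p)-class is algebraic (G1: CM anchors, in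
print for Mumford CM points given Markman) and off which algebraicity of δ₀|_t, δ₁|_t implies
algebraicity of every rational (p,p)-class (G3: generation by divisors and δ₁, δ₂, BouchetEtAl2025
§5.1 / Moonen–Zarhin) — then the Hodge conjecture holds. Mumford's families (Mumford1969NoteShimura)
are the intended inhabitants; the datum is stated abstractly because the quaternionic carriers are
not in the tree (Definition requests D1–D3). [difficulty: open-problem] (why it might fail: It is HC
for everything that is not a fibre of a Mumford-shaped datum — summit-hard by design (residual,
exempt from T1/T3/T4); it fails exactly if HC fails off the sector.) [BouchetEtAl2025,
Mumford1969NoteShimura, MoonenZarhin1999LowDim, Galluzzi2000]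

TWO-LAYER PLAN. Foreseen glued split of `InfiniteAnchorSaturation` (registered BC3 skeleton
`Lines/birth.lean`, composition proved): X ⇐ stub_charlesSchnellStrata (named fact
`charlesSchnell_algebraicityLocus_iUnion_closed`, CharlesSchnell2014Notes Prop. 11.3.11) →
stub_uncountableLocus (infinitely many anchors ⇒ UNCOUNTABLY many algebraic fibres; the open stub,
equivalent to X granted stub 1 — the 0–∞ law), through two theorems PROVED in the skeleton:
`curveStrataDichotomy` (G2a: a Zariski-closed set of complex points of a smooth projective curve is
finite or all — Noetherian decomposition + `eq_of_specializes_of_ne_top` + `pt_injective`) and the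
BC5 rung `uncountableAnchorSaturation_of` (granted the Charles–Schnell fact, UNCOUNTABLY many
algebraic fibres ⇒ algebraic at every fibre). In the Mumford instance the intended proof of
stub_uncountableLocus is the sketch's DISCRIMINANT RACE, untypable until the carriers of D1–D3 land:
K1 PolynomialCMCost (∃ B C, κ(δ_i, s) ≤ C·Δ(s)^B at every CM point s, Δ = |disc End A_s|; effective
isolation lemma + effective Markman), K2 LevelSetSparsity (a FINITE level set {s ∈ CM : κ ≤ D} has ≤
C″·D^b elements with b·B < h, h the CM-supply exponent), RACE: K1 ∧ K2 ∧ supply ⇒ some level set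
infinite ⇒ closed infinite stratum ⇒ X. Alternative second layer (line S of the sketch): a
Hecke-stable stratum (T_ℓ Z_D ⊆ Z_(D+c_ℓ) plus one CM orbit met infinitely often). Both are filed as
informal items after open, not as typed blocks.

KILL CRITERIA. Residual: `MumfordSectorComplement` (exempt). The route is closed
`refuted:InfiniteAnchorSaturation` only by a counterexample to HC on an 8-fold fibre (X ⇐ HC), so
the INFORMATIVE kill is the Mumford-instance negation N = RigidFibreDivergence: along some
discriminant-ordered CM sequence of a Mumford curve κ(δ_i, s_j) → ∞ while finite at each s_j
(equivalently, by `CurveStrataDichotomy`: every algebraicity stratum of δ_i is finite) — that is ¬X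
on that family and hence ¬HC for some fibre square A_t × A_t; refuters attack it through the toy
computation (ζ₇ fibre of X(2,3,7), BouchetEtAl2025 Thm 1.2) and the Hecke gap law. A proof elsewhere
of Grothendieck's variational Hodge conjecture over curves (route-HodgeConjecture-AnchorTransport
crux VariationalHodge, or MilnorFluxCusps/TateCuspKLift `VariationalHodgeOverCurves`) PROVES X and
moots the counting line (X is its weakening); HC for all abelian 8-folds of Mumford-square type by
any sector method (Kuga–Satake line, BouchetEtAl2025 §5.2) closes the sector without X.

NOT DECOMPOSED YET. The arithmetic layer (K1, K2, CM supply S, Hecke gap law, line S) is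
deliberately NOT typed: it needs the Mumford datum carriers (quaternion algebra over a totally real
cubic field split at one place, the uniformised compact curve, the abelian scheme and its CM points
with discriminants, Hecke correspondences) and a DEGREE-pinned complexity for fibres of a family
(the `SUPP_M` device of route-HodgeConjecture-HeckeOrbitCompactness, relative version) — over the
abstract datum a free "disc" function makes K1 collapse to X, so typing it now would be a costume.
G1 (CM anchors ⇐ Markman, folder paper Thm A) and G3 (generation, Moonen–Zarhin) are carried as
HYPOTHESES of the sector datum and are the construction obligations of its intended inhabitant, not
items. `CurveStrataDichotomy` (proved) and the Charles–Schnell strata fact (named Literature fact)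
live in the registered skeleton `Lines/birth.lean`, landed by provers with `--supports`.

CHEAPEST FALSIFIER. (i) Lookup, run: is X (or VHC over curves) refuted or proved in print? — no:
CharlesSchnell2014Notes p.480 "very little seems to be known about the variational Hodge
conjecture"; BouchetEtAl2025 p.15 "unknown whether [δ₁, δ₂] are algebraic". (ii) In-Lean, run:
BC2/BC7 probes — X ↛ HC and HC ↛ X by the fixed batteries (all FAIL/CLEAN), `exact?` finds no X in
Mathlib + Literature + Theses (BC4). (iii) The informative cheap check a refuter runs first: at the
CM point t = ζ₇ of the explicit family C_(7,t) (BouchetEtAl2025 Thm 1.2; A_t ~ quotient of Jac of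
the degree-14 Fermat curve) compute κ(δ_i) from Shioda's Fermat cycles and compare with one further
CM fibre — growth beyond any polynomial in the discriminant kills K1 (the intended proof of the open
stub), not X.

NUMBERS. Relative dimension 8 = dim(A_t × A_t), A_t a Mumford-type abelian fourfold; codimension p =
2, degree 4; two exceptional classes δ₁, δ₂ ∈ H⁴(A², ℚ) outside the divisor ring, generating with
divisors all Hodge classes of A² (BouchetEtAl2025 §5.1). Explicit Mumford curves: Δ(2,3,7), Δ(2,3,9)
triangle curves, discriminants 2^36·3^36·7^10·t^54(t−1)^12 and 2^72·3^34·t^52(t−1)^28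
(BouchetEtAl2025 §4). CM supply exponent h and cost exponent B are the unmeasured numbers of the
race (K1/K2).

DEFINITION REQUESTS. D1 `MumfordTypeShimuraCurveDatum`
(Literature/AlgebraicGeometry/ShimuraVarieties): totally real cubic F, quaternion B/F split at
exactly one real place with Cor_(F/ℚ) B ≅ M₈(ℚ), Γ, the compact curve V = Γ\𝔥 and Mumford's
principally polarised abelian scheme 𝒜 → V of relative dimension 4 (Mumford1969NoteShimura;
hypothesis-structure shape of `UnitaryBallQuotientDatum`), with its CM points and discriminant Δ(s)
= |disc End A_s|. D2 `mumfordExceptionalClass` (i : Fin 2): the G-invariant classes δ_i ∈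
H⁴(𝒜₂(ℂ);ℚ) of the fibre square (MoonenZarhin1999LowDim, BouchetEtAl2025 §5.1). D3 relative `SUPP_M`
/ projective complexity κ of a class on the fibres of a polarised family (degree-pinned, cf.
HeckeOrbitCompactness `OrbitDegreeBound`). Cite facts wanted: Kuga (HC for a single Mumford-type
fourfold), Galluzzi2000 (Kuga–Satake for Mumford type), Noot (CM points of Mumford curves).

Novelty: Searches (2026-08-17): lit search --hybrid "variational Hodge conjecture flat section algebraic one
fibre curve" (10 book hits: cattani2014 PMN49 pp.477–484, voisin2003 II, kerr2016, green1994); lit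
vsearch "<X in prose>" (10 hits, none stating X: hartshorne1977, deligne1982, voisin2002/2003); lit
search --hybrid "van Geemen … Weil type dense" (green1994 pp.214–236); lit read arxiv:2510.00093
--grep (p.15 §5.1 located); lit galaxy search "Mumford-type|fake elliptic curve|Mumford's
family|Mumford type abelian" --star all and "Mumford-type|Mumford type" --star pdf: both `queued too
long (> 90 s)` twice — galaxy saturated this session (null recorded, not a claim); ledger negatives
--problem HodgeConjecture (3, unrelated); lean: BC4 `exact?` on X/R in Mathlib+Literature+5 Theses
FAILS; tree search found the nearest typed statements `AnchorTransport.VariationalHodge`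
(stmt-HodgeConjecture-1076), `MilnorFluxCusps.VariationalHodgeOverCurves`,
`HeckeOrbitCompactness.OrbitDegreeBound`.
Nearest prior art found: [corpus:book:cattani2014-hodge-theory-princeton-mathematical-notes-49 p.477
Conj. 11.3.1, p.479 Prop. 11.3.5/Cor. 11.3.6, p.484 Prop. 11.3.11] Grothendieck's variational Hodge
conjecture (one anchor, any smooth connected base) and the countable-union structure of the
algebraicity locus; [corpus:paper:arxiv-2510.00093 p.15] the Mumford-square sector named open with
two proposed attacks (explicit surfaces in C⁴; Kuga–Satake/K3) — neither uses the CM points; in-tree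
route-HodgeConj  [refs: 2510.00093, arxiv:2510.00093, book:cattani2014-hodge-theory-princeton-mathematical-notes-49, paper:arxiv-2510.00093]

Barriers (technique_class: special-point-saturation, strata, cm-counting): - technique_class: special-point-saturation, strata, cm-counting
- Literature.Barriers.HodgeConjecture.Andre1996_hodgeClassesOnAbelianVarieties_motivated: outside on
the thesis side — motivated-ness is never used (André's deformation principle says δ_t is motivated
iff δ_s is, which is weaker than X); it PRICES the kill side: a RigidFibreDivergence counterexample
on a Mumford fibre square would also refute the Lefschetz standard conjecture
(`not_lefschetzStandardConjecture_of_counterexample`). Same cluster, uncatalogued files: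
ExceptionalHodgeClasses (`Mumford1968_simpleFourfold_exceptionalHodgeClasses`,
`Weil1977_exceptionalHodgeClasses`) — X lives exactly on the classes it names and evades its
technique class by never using divisor generation (algebraicity enters at CM anchors through
Markman's Weil-class theorem and is propagated by strata) [corpus:paper:arxiv-2510.00093 p.15;
corpus:book:green1994-algebraic-cycles-hodge-theory-lectures-given-at p.218 Thm 4.5];
AbsoluteHodgeClasses (Deligne 1982) — Principle B gives the absolute-Hodge analogue of X for free
[corpus:book:cattani2014-hodge-theory-princeton-mathematical-notes-49 p.480 Thm 11.3.7], so the
lever is the complexity of honest cycles at CM fibres, not absoluteness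
[galaxy:pdf:-8405055998839152860].
- Literature.Barriers.HodgeConjecture.CattaniDeligneKaplan1995_hodgeLocus_algebraicFor: outside —
the strata used are ALGEBRAICITY loci (Charles–Schnell, relative Hilbert schemes), Zariski-closed on
points by constructio

sub-problem: HodgeConjecture · status: draft · opened planner-type-0fbdc4e309-0 2026-08-17T19:12:30Z · rev 0 · ledger route-HodgeConjecture-MumfordCurveRigidFibreCount
GENERATED by the gate from the ledger (D-0016/17). Provers cite these decls: `theorem foo : Summit.HodgeConjecture.HodgeConjecture.Theses.MumfordCurveRigidFibreCount.<Decl> := …` in Summits/HodgeConjecture/HodgeConjecture/Theorems/<Name>.lean.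
-/

namespace Summit.HodgeConjecture.HodgeConjecture.Theses.MumfordCurveRigidFibreCount

open scoped BigOperators Topology Manifold Classical MeasureTheory ProbabilityTheory Matrix InnerProductSpace ComplexConjugate ContinuousMap
open Filter Set Function TopologicalSpace MeasureTheory

attribute [summit_statement] _root_.HodgeConjecture

/-- item stmt-HodgeConjecture-20123 · crux · rank 2 · open · by planner
why it might fail: Only with HC. Strategic failure = PROPER CM COST: κ(s) finite at every CM point but unbounded (every stratum finite), the anchors dodging the countably many finite strata one by one — nothing known excludes it (BKU2024: special points are sparse in every uniform sense).
sources: BouchetEtAl2025, CharlesSchnell2014Notes, Mumford1969NoteShimura, MoonenZarhin1999LowDim, Markman2025SecantWeil, BaldiKlinglerUllmo2024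
[crux] X itself (sketch item X / BHPS §5.1 instance): for every smooth projective family f : 𝒜 → V
of relative dimension 8 over a smooth projective geometrically irreducible curve V/ℂ with 𝒜
quasi-projective, every global class δ ∈ H⁴(𝒜(ℂ);ℂ) whose fibre restrictions are all rational of
type (2,2), algebraic at infinitely many complex points of V, is algebraic at every complex point. A
consequence of HC (any failure is a non-algebraic rational (2,2)-class on a smooth projective
8-fold); implied by Grothendieck's variational Hodge conjecture on curve bases; the Mumford fibre
squares with δ = δ_i and anchors = CM points are the instance of record. [difficulty: open-problem] -/
@[route_item "route-HodgeConjecture-MumfordCurveRigidFibreCount", crux]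
def InfiniteAnchorSaturation : Prop :=
  ∀ (V 𝒜 : Literature.AlgebraicGeometry.Motives.SchemeOver ℂ) (f : 𝒜 ⟶ V), Literature.AlgebraicGeometry.Motives.IsSmoothProjective 1 V → Literature.AlgebraicGeometry.Motives.IsSmoothProjectiveFamily f 8 → Literature.AlgebraicGeometry.HodgeTheory.IsQuasiProjectiveOver 𝒜 → ∀ (δ : Literature.AlgebraicGeometry.HodgeTheory.complexBetti 𝒜 (2 * 2)), (∀ t : Literature.AlgebraicGeometry.Motives.ComplexPoints V, Literature.AlgebraicGeometry.HodgeTheory.IsRationalClass (Literature.AlgebraicGeometry.HodgeTheory.complexBetti.map (Literature.AlgebraicGeometry.Motives.fiberι f t) (2 * 2) δ) ∧ Literature.AlgebraicGeometry.HodgeTheory.IsOfHodgeType 8 (Literature.AlgebraicGeometry.Motives.fiberOver f t) (2 * 2) 2 2 (Literature.AlgebraicGeometry.HodgeTheory.complexBetti.map (Literature.AlgebraicGeometry.Motives.fiberι f t) (2 * 2) δ)) → {s : Literature.AlgebraicGeometry.Motives.ComplexPoints V | Literature.AlgebraicGeometry.HodgeTheory.complexBetti.map (Literature.AlgebraicGeometry.Motives.fiberι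 f s) (2 * 2) δ ∈ Literature.AlgebraicGeometry.HodgeTheory.algebraicClasses (Literature.AlgebraicGeometry.Motives.fiberOver f s) 2}.Infinite → ∀ t : Literature.AlgebraicGeometry.Motives.ComplexPoints V, Literature.AlgebraicGeometry.HodgeTheory.complexBetti.map (Literature.AlgebraicGeometry.Motives.fiberι f t) (2 * 2) δ ∈ Literature.AlgebraicGeometry.HodgeTheory.algebraicClasses (Literature.AlgebraicGeometry.Motives.fiberOver f t) 2

/-- item stmt-HodgeConjecture-20124 · crux · rank 3 · open · by planner
why it might fail: It is HC for everything that is not a fibre of a Mumford-shaped datum — summit-hard by design (residual, exempt from T1/T3/T4); it fails exactly if HC fails off the sector.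
sources: BouchetEtAl2025, Mumford1969NoteShimura, MoonenZarhin1999LowDim, Galluzzi2000
[crux] RESIDUAL (declared `residual`; HC off the Mumford-shaped fibre-square sector): if the Hodge
conjecture holds for every fibre of every MUMFORD-SHAPED SECTOR DATUM — a smooth projective family f
: 𝒜 → V of relative dimension 8 over a smooth projective curve, 𝒜 quasi-projective, two global
degree-4 classes δ₀, δ₁ with rational (2,2) fibre restrictions, an infinite set CM ⊆ V(ℂ) at whose
fibres every rational (p,p)-class is algebraic (G1: CM anchors, in print for Mumford CM points given
Markman) and off which algebraicity of δ₀|_t, δ₁|_t implies algebraicity of every rational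
(p,p)-class (G3: generation by divisors and δ₁, δ₂, BouchetEtAl2025 §5.1 / Moonen–Zarhin) — then the
Hodge conjecture holds. Mumford's families (Mumford1969NoteShimura) are the intended inhabitants;
the datum is stated abstractly because the quaternionic carriers are not in the tree (Definition
requests D1–D3). [difficulty: open-problem] -/
@[route_item "route-HodgeConjecture-MumfordCurveRigidFibreCount", crux]
def MumfordSectorComplement : Prop :=
  (∀ (V 𝒜 : Literature.AlgebraicGeometry.Motives.SchemeOver ℂ) (f : 𝒜 ⟶ V), Literature.AlgebraicGeometry.Motives.IsSmoothProjective 1 V → Literature.AlgebraicGeometry.Motives.IsSmoothProjectiveFamily f 8 → Literature.AlgebraicGeometry.HodgeTheory.IsQuasiProjectiveOver 𝒜 → ∀ (δ : Fin 2 → Literature.AlgebraicGeometry.HodgeTheory.complexBetti 𝒜 (2 * 2)) (CM : Set (Literature.AlgebraicGeometry.Motives.ComplexPoints V)), (∀ (t : Literature.AlgebraicGeometry.Motives.ComplexPoints V) (i : Fin 2), Literature.AlgebraicGeometry.HodgeTheory.IsRationalClass (Literature.AlgebraicGeometry.HodgeTheory.complexBetti.map (Literature.AlgebraicGeometry.Motives.fiberι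 f t) (2 * 2) (δ i)) ∧ Literature.AlgebraicGeometry.HodgeTheory.IsOfHodgeType 8 (Literature.AlgebraicGeometry.Motives.fiberOver f t) (2 * 2) 2 2 (Literature.AlgebraicGeometry.HodgeTheory.complexBetti.map (Literature.AlgebraicGeometry.Motives.fiberι f t) (2 * 2) (δ i))) → CM.Infinite → (∀ s ∈ CM, ∀ (p : ℕ) (c : Literature.AlgebraicGeometry.HodgeTheory.complexBetti (Literature.AlgebraicGeometry.Motives.fiberOver f s) (2 * p)), Literature.AlgebraicGeometry.HodgeTheory.IsRationalClass c → Literature.AlgebraicGeometry.HodgeTheory.IsOfHodgeType 8 (Literature.AlgebraicGeometry.Motives.fiberOver f s) (2 * p) p p c → c ∈ Literature.AlgebraicGeometry.HodgeTheory.algebraicClasses (Literature.AlgebraicGeometry.Motives.fiberOver f s) p) → (∀ t ∉ CM, (∀ i : Fin 2, Literature.AlgebraicGeometry.HodgeTheory.complexBetti.map (Literature.AlgebraicGeometry.Motives.fiberι f t) (2 * 2) (δ i) ∈ Literature.AlgebraicGeometry.HodgeTheory.algebraicClasses (Literature.AlgebraicGeometry.Motives.fiberOver f t) 2) → ∀ (p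 : ℕ) (c : Literature.AlgebraicGeometry.HodgeTheory.complexBetti (Literature.AlgebraicGeometry.Motives.fiberOver f t) (2 * p)), Literature.AlgebraicGeometry.HodgeTheory.IsRationalClass c → Literature.AlgebraicGeometry.HodgeTheory.IsOfHodgeType 8 (Literature.AlgebraicGeometry.Motives.fiberOver f t) (2 * p) p p c → c ∈ Literature.AlgebraicGeometry.HodgeTheory.algebraicClasses (Literature.AlgebraicGeometry.Motives.fiberOver f t) p) → ∀ t : Literature.AlgebraicGeometry.Motives.ComplexPoints V, Literature.AlgebraicGeometry.HodgeTheory.HodgeConjectureFor 8 (Literature.AlgebraicGeometry.Motives.fiberOver f t)) → _root_.HodgeConjecture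

/-- item stmt-HodgeConjecture-20125 · assembly · rank 1 · closed · proved by Summit.HodgeConjecture.HodgeConjecture.Theorems.mumfordCurveRigidFibreCount_assembly_proof @ f902fcb619ed (prover) · by planner
sources: BouchetEtAl2025, CharlesSchnell2014Notes
[assembly] InfiniteAnchorSaturation → MumfordSectorComplement → the Hodge conjecture (the residual
applied to the sector theorem obtained from X). -/
@[route_item "route-HodgeConjecture-MumfordCurveRigidFibreCount"]
def Assembly : Prop :=
  InfiniteAnchorSaturation → MumfordSectorComplement → _root_.HodgeConjecture

/-! D-0027 §2.1 — DECIDING THEOREM (planner-authored via `route open/edit --closes-file`; by planner-type-0fbdc4e309-0 2026-08-17T19:12:30Z):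
its hypotheses are this route's items and its conclusion the sub-problem Statement (glue_lint), and it elaborates with this file. -/

@[closes "route-HodgeConjecture-MumfordCurveRigidFibreCount"] theorem closes (hX : InfiniteAnchorSaturation) (hR : MumfordSectorComplement) : _root_.HodgeConjecture := by
  refine hR ?_
  intro V 𝒜 f hV hf h𝒜 δ CM hδ hinf hCM hgen t
  refine ⟨Literature.AlgebraicGeometry.HodgeTheory.nonempty_hodgeModel_holds (hf.isSmoothProjective t), ?_⟩
  intro p c hc hpp
  by_cases ht : t ∈ CM
  · exact hCM t ht p c hc hpp
  · refine hgen t ht (fun i => ?_) p c hc hpp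
    refine hX V 𝒜 f hV hf h𝒜 (δ i) (fun t' => hδ t' i) (hinf.mono ?_) t
    intro s hs
    exact hCM s hs 2 _ (hδ s i).1 (hδ s i).2

end Summit.HodgeConjecture.HodgeConjecture.Theses.MumfordCurveRigidFibreCount
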